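import Summits.QuantumFields.BalabanUV.Beta.GAN24.ResolventFamilyRealStructure
import Summits.QuantumFields.BalabanUV.Beta.GAN24.EffectiveFormInsertionLaw

/-!
# `BalabanUV.Beta.GAN24.FirstOrderModelRealLetters` — binder row G-an2-4 ∕ (CONV-C), route R7 «TWO CURRENCIES», PART 167: THE LETTERS OF THE FIRST-ORDER MODEL ARE REAL, AND ITS
# EFFECTIVE FORM WITH BACKGROUND IS A RESOLVENT-FORM SANDWICH — so PART 166 reads the ONE-LOOP POLARIZATION (1.20) OF THE LINEAGE'S MODEL FAMILY at every level `k` on every torus: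
# `((Π_{ij} : ℝ) : ℂ) = −½·(tr(𝒢·Σ_{ij}) − tr(𝒢·Σ_i·𝒢·Σ_j))` in the letters `D = Δ_a^{(k)} = calDalev`, `P_i = P(V_i)^{(k)} = Pmodel`, `Q = (L^d)^k•QB_tow`, `Q′ = QB_towᴴ` (`c = Q·D⁻¹·Q′ = c_k = unitCovB`),
# for REAL backgrounds `V_i` and ANY real background-independent constraint `Q̃` (unit b2b-balaban-gan24-p3, gen 57; v1)

NOT IN PRINT; OUR PROOF ([folklore] bookkeeping BY NAME over b05's `B5RealFields` (`IsReal`, `isReal_DeltaA_inv`, `isReal_fdiff`, closure under `+ ∕ • ∕ * ∕ ᴴ ∕ ⁻¹`), NE2's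
`KingPairingPlantedLaw.calDalev_inv ∕ isUnit_det_calDalev`, `BalabanLineAverage.QB_apply`, `CovariantAveragingTower.Atow ∕ avgTow`, `FirstOrderBackgroundModel.firstOrder ∕ Pmodel`, PART 118
`EffectiveFormInsertionLaw.isUnit_det_unitCovB_and_opNorm_inv_le`, and PART 166 `ResolventFamilyRealStructure.ofReal_polarization_of_isReal`.  [Balaban1984PropagatorsI] p. 17 «Field configurations are
real valued functions A defined at bonds of the lattice», (1.18) p. 20, (1.69)∕(1.73) pp. 29–30 and [Balaban1987RG1] (1.20) p. 264 LOCATE the objects; nothing printed is a hypothesis.)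
HONEST FRAMING (cell contract, verbatim): «discharging `BetaPertH` makes Bałaban's UV stability UNCONDITIONAL — a real constructive-QFT result; it is NOT the continuum limit and NOT the
Clay problem.»  HONEST DEPENDENCY (verbatim): «continuum YM on T⁴ ⇐ BetaPertH ∧ nine spine estimates (0/9 proved); BetaPertH ⇐ (D1) ∧ (D4) ∧ CAP+tail; G-an2-4 gates asym, D1 and NE2/3/4.»

WHY (PART 166's located item (c′)).  PARTs 164–166 are generic; this file instantiates their letters on road P3's model: `D = Δ_a^{(k)}`, `P_i = P(V_i)^{(k)} = Σ_μ diag(V_i^{(k)}{}_μ)∇^{(k)}_μ`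
(NE2's first-order background model, one background `V_i` per external coordinate `i`), `Q·X·Q′ = (L^d)^k·QB_tow X QB_towᴴ = avgTow` (the (1.18)-averaged unit-lattice image), so that
`c(B) = Q·(D + Σ_i B_i•P_i)⁻¹·Q′` IS the lineage's `c_k` with background `Σ_i B_iV_i` (PARTs 118 ∕ 152 ∕ 161: `avgTow (QBlev L M) (L^d) (k′ ↦ (Δ_a^{(k′)} + Σ_i B_i P(V_i)^{(k′)})⁻¹) k`) and
`c(0) = c_k = unitCovB` is invertible (PART 118).  Every letter is REAL for real backgrounds (§1), so PART 166 §3 applies: for every real background-independent constraint `Q̃` on the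
unit lattice (read through any enumeration `e : idx ≃ Fin n`) and every real shift `S₀` (the lineage's `−a″·1`), the one-loop polarization of pv25's `Family`
`B ↦ (re Q̃, (re c(B))⁻¹ + re S₀)` is, complexified, «½·BUBBLE − ½·TADPOLE» of the lineage's OWN `ℂ`-typed insertion words against an2's `flucCov` (§3).  WHAT REMAINS (PART 165 (a), (b);
unchanged): the letter `𝒢 = flucCov(c_k⁻¹ + S₀, Q̃)` in the INPUT-triple currency and the loop contraction as a unit-lattice kernel; and the CHOICE of `Q̃` (Bałaban's one-step averaging on
the unit torus needs volumes divisible by `L`, which the lineage's `evenPeriod` family is not — a planner-level reshaping, not attempted).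

WHAT THIS FILE PROVES (0 sorry, 0 `def`; `L ≥ 1`, torus `M`, `a > 0`, level `k`; `idx L M k` the fine index, `idx L M 0` the unit index):
* §1 `isReal_diagonal`, `isReal_firstOrder`, **`isReal_Pmodel`** (real `V`), **`isReal_calGlev`**, **`isReal_calDalev`**, **`isReal_QB ∕ isReal_QBlev`**, `isReal_Atow`, `isReal_avgTow`, `isReal_submatrix`,
  **`isReal_pencil_model`**, **`isReal_pertCov`** (`c_k(B)` for real `B`, real `V_i`).
* §2 `avgTow_eq_sandwich` (`avgTow A r X k = ((r^k)•A_tow)·X_k·A_towᴴ`), **`pertCov_eq_sandwich`** (the lineage's `c_k(B)` IS PART 164's sandwich `Q·(D + Σ_i B_i•P_i)⁻¹·Q′`), `isUnit_det_sandwich_zero`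
  (`c(0) = c_k` invertible, PART 118).
* §3 **`ofReal_polarization_firstOrderModel`** — PART 166 `ofReal_polarization_of_isReal` ON THESE LETTERS (unit index enumerated by `e : idx L M 0 ≃ Fin n`; `Q̃ : m × n` and `S₀` real; ONE displayed
  hypothesis: the bordered matrix `[[c_k⁻¹ + S₀, Q̃ᵀ],[Q̃, 0]]` is nonsingular — pv25's `Regular`).
WHAT IT IS NOT: no limit `T ↗ ℤ^d`, no rate, no choice of `Q̃`; NOT Bałaban's `Δ^{(k)}(U_{k+1}(exp iB))` (row an1's dictionary).  SUPPLIER work; NEVER «G-an2-4 closed»; NOT (CONV-C), NOT D1, NOT `BetaPertH`,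
NOT continuum, NOT Clay.  Records: `HOME/b2b-balaban-gan24-p3/gen57/README.md`.
-/

noncomputable section

open Matrix
open scoped BigOperators ComplexConjugate

namespace Summit.QuantumFields.BalabanUV.Beta.GAN24.FirstOrderModelRealLetters

open Literature.MathematicalPhysics.QuantumFieldTheory.Balaban1983to89.Beta
open Literature.MathematicalPhysics.QuantumFieldTheory.Balaban1983to89.Beta.CompositionSingular (flucCov)
open Literature.MathematicalPhysics.QuantumFieldTheory.Balaban1983to89.B5Prop11Plancherel (Tor fine fdiff)
open Literature.MathematicalPhysics.QuantumFieldTheory.Balaban1983to89.B5RealFields (IsReal reM isReal_fdiff isReal_DeltaA_inv)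
open Literature.MathematicalPhysics.QuantumFieldTheory.Balaban1983to89.B5DeltaA169 (calG_eq_DeltaA_inv)
open Literature.MathematicalPhysics.QuantumFieldTheory.Balaban1983to89.B5G183RateUnitTower (lev)
open Summit.QuantumFields.BalabanUV.T4Continuum
open Summit.QuantumFields.BalabanUV.T4Continuum.CovariantAveragingTower (Atow avgTow Atow_zero Atow_succ)
open Summit.QuantumFields.BalabanUV.T4Continuum.BalabanAveragedTowerUnit (idx QBlev calGlev unitCovB)
open Summit.QuantumFields.BalabanUV.T4Continuum.BalabanLineAverage (QB QB_apply)
open Summit.QuantumFields.BalabanUV.T4Continuum.KingPairingPlantedLaw (calDalev calDalev_inv isUnit_det_calDalev)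
open Summit.QuantumFields.BalabanUV.T4Continuum.FirstOrderBackgroundModel (firstOrder Pmodel)
open Summit.QuantumFields.BalabanUV.Beta.GAN24.EffectiveFormInsertionLaw (isUnit_det_unitCovB_and_opNorm_inv_le)
open Summit.QuantumFields.BalabanUV.Beta.GAN24.ResolventFamilyRealStructure (ofReal_polarization_of_isReal)

/-! ## §1 The letters are real -/

section Letters

variable {d : ℕ}

/-- A diagonal matrix with real entries is real. [folklore] -/
theorem isReal_diagonal {m : Type*} [DecidableEq m] {v : m → ℂ} (hv : ∀ i, conj (v i) = v i) : IsReal (Matrix.diagonal v) := fun i j => by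
  by_cases h : i = j
  · subst h; rw [Matrix.diagonal_apply_eq, hv]
  · rw [Matrix.diagonal_apply_ne _ h, map_zero]

/-- A submatrix (e.g. a reindexing) of a real matrix is real. [folklore] -/
theorem isReal_submatrix {m k m' k' : Type*} {A : Matrix m k ℂ} (hA : IsReal A) (f : m' → m) (g : k' → k) : IsReal (A.submatrix f g) :=
  fun i j => hA (f i) (g j)

/-- **NE2's first-order perturbation `Σ_μ diag(W_μ)·∇^c_μ` is real** for a real coefficient field `W` and a real lattice factor `c` (b05's `isReal_fdiff`). [folklore] -/
theorem isReal_firstOrder (Nf : Fin d → ℕ) [∀ μ, NeZero (Nf μ)] {c : ℂ} (hc : conj c = c) {W : Fin d → (Tor Nf × Fin d → ℂ)}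
    (hW : ∀ μ i, conj (W μ i) = W μ i) : IsReal (firstOrder Nf c W) := by
  unfold firstOrder
  exact IsReal.sum fun μ _ => (isReal_diagonal (hW μ)).mul (isReal_fdiff Nf hc μ)

/-- **`P(V)^{(k)} = Pmodel L M V k` is real for a real background `V`.** [folklore] -/
theorem isReal_Pmodel (L : ℕ) [NeZero L] (M : Fin d → ℕ) [∀ μ, NeZero (M μ)] {V : (k : ℕ) → Fin d → (idx L M k → ℂ)}
    (hV : ∀ k μ i, conj (V k μ i) = V k μ i) (k : ℕ) : IsReal (Pmodel L M V k) := by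
  unfold Pmodel
  exact isReal_firstOrder _ (by simp) (hV k)

/-- **`𝒢^{(k)} = calGlev` is real** (`calG = Δ_a⁻¹`, b05's `isReal_DeltaA_inv`). [folklore] -/
theorem isReal_calGlev (L : ℕ) [NeZero L] (M : Fin d → ℕ) [∀ μ, NeZero (M μ)] (a : ℝ) (ha : 0 < a) (k : ℕ) : IsReal (calGlev L M a ha k) := by
  unfold calGlev
  rw [calG_eq_DeltaA_inv]
  exact isReal_DeltaA_inv _ _ _

/-- **`Δ_a^{(k)} = calDalev` is real** (the inverse of the real invertible `𝒢^{(k)}`). [folklore] -/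
theorem isReal_calDalev (L : ℕ) [NeZero L] (M : Fin d → ℕ) [∀ μ, NeZero (M μ)] (a : ℝ) (ha : 0 < a) (k : ℕ) : IsReal (calDalev L M a ha k) := by
  rw [← Matrix.nonsing_inv_nonsing_inv (calDalev L M a ha k) (isUnit_det_calDalev L M a ha k), calDalev_inv]
  exact (isReal_calGlev L M a ha k).inv

/-- **Bałaban's one-step averaging `QB` ((1.11)∕(1.18)) is real** (its entries are `R^{−(d+1)}`-weighted counts, `QB_apply`). [folklore] -/
theorem isReal_QB (N R : ℕ) [NeZero N] [NeZero R] (M : Fin d → ℕ) [∀ μ, NeZero (M μ)] : IsReal (QB N R M) := fun i x => by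
  rw [QB_apply]
  simp only [map_mul, map_inv₀, map_pow, map_natCast, map_sum, apply_ite conj, map_one, map_zero]

/-- `QBlev L M k` is real. [folklore] -/
theorem isReal_QBlev (L : ℕ) [NeZero L] (M : Fin d → ℕ) [∀ μ, NeZero (M μ)] (k : ℕ) : IsReal (QBlev L M k) := isReal_QB _ _ _

/-- The composite averaging `Atow A k` of real one-step averagings is real. [folklore] -/
theorem isReal_Atow {ι : ℕ → Type} [∀ k, Fintype (ι k)] [∀ k, DecidableEq (ι k)] {A : (k : ℕ) → Matrix (ι k) (ι (k + 1)) ℂ} (hA : ∀ k, IsReal (A k)) :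
    ∀ k, IsReal (Atow A k)
  | 0 => by rw [Atow_zero]; exact IsReal.one
  | k + 1 => by rw [Atow_succ]; exact (isReal_Atow hA k).mul (hA k)

/-- The unit-lattice image `avgTow A r X k = r^k•A_tow X_k A_towᴴ` of a real level operator under real averagings is real. [folklore] -/
theorem isReal_avgTow {ι : ℕ → Type} [∀ k, Fintype (ι k)] [∀ k, DecidableEq (ι k)] {A : (k : ℕ) → Matrix (ι k) (ι (k + 1)) ℂ} (hA : ∀ k, IsReal (A k)) (r : ℝ)
    {X : (k : ℕ) → Matrix (ι k) (ι k) ℂ} {k : ℕ} (hX : IsReal (X k)) : IsReal (avgTow A r X k) := by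
  unfold avgTow
  refine IsReal.smul ?_ (((isReal_Atow hA k).mul hX).mul (isReal_Atow hA k).conjTranspose)
  rw [map_pow, Complex.conj_ofReal]

/-- **The pencil of the model, `Δ_a^{(k)} + Σ_i B_i•P(V_i)^{(k)}`, is real** for a real background value `B` and real backgrounds `V_i`. [folklore] -/
theorem isReal_pencil_model {ι : Type*} [Fintype ι] (L : ℕ) [NeZero L] (M : Fin d → ℕ) [∀ μ, NeZero (M μ)] (a : ℝ) (ha : 0 < a)
    {V : ι → (k : ℕ) → Fin d → (idx L M k → ℂ)} (hV : ∀ i k μ x, conj (V i k μ x) = V i k μ x) (B : ι → ℝ) (k : ℕ) :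
    IsReal (calDalev L M a ha k + ∑ i, ((B i : ℝ) : ℂ) • Pmodel L M (V i) k) :=
  (isReal_calDalev L M a ha k).add (IsReal.sum fun i _ => IsReal.smul (Complex.conj_ofReal _) (isReal_Pmodel L M (hV i) k))

/-- **The lineage's effective covariance with background, `c_k(B) = avgTow (QBlev) (L^d) (k′ ↦ (Δ_a^{(k′)} + Σ_i B_iP(V_i)^{(k′)})⁻¹) k`, is real** for real `B`, `V_i`. [folklore] -/
theorem isReal_pertCov {ι : Type*} [Fintype ι] (L : ℕ) [NeZero L] (M : Fin d → ℕ) [∀ μ, NeZero (M μ)] (a : ℝ) (ha : 0 < a)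
    {V : ι → (k : ℕ) → Fin d → (idx L M k → ℂ)} (hV : ∀ i k μ x, conj (V i k μ x) = V i k μ x) (B : ι → ℝ) (k : ℕ) :
    IsReal (avgTow (QBlev L M) ((L : ℝ) ^ d) (fun k' => (calDalev L M a ha k' + ∑ i, ((B i : ℝ) : ℂ) • Pmodel L M (V i) k')⁻¹) k) :=
  isReal_avgTow (isReal_QBlev L M) _ (isReal_pencil_model L M a ha hV B k).inv

end Letters

/-! ## §2 The effective covariance with background is PART 164's sandwich -/

section Sandwich

variable {d : ℕ}

/-- `avgTow A r X k = ((r^k)•A_tow k)·X_k·(A_tow k)ᴴ`. [folklore] -/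
theorem avgTow_eq_sandwich {ι : ℕ → Type} [∀ k, Fintype (ι k)] [∀ k, DecidableEq (ι k)] (A : (k : ℕ) → Matrix (ι k) (ι (k + 1)) ℂ) (r : ℝ)
    (X : (k : ℕ) → Matrix (ι k) (ι k) ℂ) (k : ℕ) :
    avgTow A r X k = (((r : ℂ) ^ k) • Atow A k) * X k * (Atow A k)ᴴ := by
  unfold avgTow
  rw [Matrix.smul_mul, Matrix.smul_mul]

/-- **THE LINEAGE's `c_k(B)` IS THE SANDWICH `Q·(D + Σ_i B_i•P_i)⁻¹·Q′`** with `Q = (L^d)^k•QB_tow`, `D = Δ_a^{(k)}`, `P_i = P(V_i)^{(k)}`, `Q′ = QB_towᴴ` — read through any reindexing `f` of the unit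
index (e.g. an enumeration `idx L M 0 ≃ Fin n`). [folklore] -/
theorem pertCov_eq_sandwich {ι : Type*} [Fintype ι] {u : Type*} (L : ℕ) [NeZero L] (M : Fin d → ℕ) [∀ μ, NeZero (M μ)] (a : ℝ) (ha : 0 < a)
    (V : ι → (k : ℕ) → Fin d → (idx L M k → ℂ)) (B : ι → ℝ) (k : ℕ) (f : u → idx L M 0) :
    (avgTow (QBlev L M) ((L : ℝ) ^ d) (fun k' => (calDalev L M a ha k' + ∑ i, ((B i : ℝ) : ℂ) • Pmodel L M (V i) k')⁻¹) k).submatrix f f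
      = (((((L : ℝ) ^ d : ℝ) : ℂ) ^ k) • Atow (QBlev L M) k).submatrix f id * (calDalev L M a ha k + ∑ i, ((B i : ℝ) : ℂ) • Pmodel L M (V i) k)⁻¹
          * ((Atow (QBlev L M) k)ᴴ).submatrix id f := by
  rw [avgTow_eq_sandwich, Matrix.submatrix_mul _ _ f id f (Function.bijective_id), Matrix.submatrix_mul _ _ f id id (Function.bijective_id), Matrix.submatrix_id_id]

/-- At `B = 0` the sandwich is `c_k = unitCovB`, which is invertible (PART 118 `isUnit_det_unitCovB_and_opNorm_inv_le`); read through an equivalence of the unit index. [folklore] -/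
theorem isUnit_det_sandwich_zero {u : Type*} [Fintype u] [DecidableEq u] (L : ℕ) [NeZero L] (M : Fin d → ℕ) [∀ μ, NeZero (M μ)] (a : ℝ) (ha : 0 < a) (k : ℕ)
    (e : u ≃ idx L M 0) :
    IsUnit ((((((L : ℝ) ^ d : ℝ) : ℂ) ^ k) • Atow (QBlev L M) k).submatrix e id * (calDalev L M a ha k)⁻¹ * ((Atow (QBlev L M) k)ᴴ).submatrix id e).det := by
  have h : (((((L : ℝ) ^ d : ℝ) : ℂ) ^ k) • Atow (QBlev L M) k).submatrix e id * (calDalev L M a ha k)⁻¹ * ((Atow (QBlev L M) k)ᴴ).submatrix id e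
      = (unitCovB L M a ha k).submatrix e e := by
    rw [unitCovB, avgTow_eq_sandwich, Matrix.submatrix_mul _ _ e id e (Function.bijective_id), Matrix.submatrix_mul _ _ e id id (Function.bijective_id),
      Matrix.submatrix_id_id, calDalev_inv]
  rw [h, Matrix.det_submatrix_equiv_self]
  exact (isUnit_det_unitCovB_and_opNorm_inv_le L M a ha k).1

end Sandwich

/-! ## §3 The one-loop polarization of the model family, in the lineage's letters -/

section Polarization

variable {d : ℕ} {ι : Type*} [Fintype ι] [DecidableEq ι] {n m : ℕ}

/-- **THE ONE-LOOP POLARIZATION (1.20) OF THE FIRST-ORDER MODEL AT LEVEL `k` ON THE TORUS `M`, IN THE LINEAGE'S `ℂ`-TYPED LETTERS.**  Data: `L ≥ 1`, `a > 0`, real backgrounds `V_i`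
(one per external coordinate `i : ι`), an enumeration `e : Fin n ≃ idx L M 0` of the unit lattice, a real background-independent constraint `Q̃ : m × n`, a real shift `S₀` (the lineage's `−a″·1`).
Letters: `D = Δ_a^{(k)}`, `P_i = P(V_i)^{(k)}`, and `Q = ((L^d)^k•QB_tow)∘e`, `Q′ = e∘QB_towᴴ` given BY EQUATIONS `hQ`, `hQ′` (so `Q·(D + Σ_i B_i•P_i)⁻¹·Q′ = c_k(B)∘e`, `pertCov_eq_sandwich`), all REAL
(§1), `D` and `c = c_k` invertible (NE2, PART 118 — DISCHARGED).  Then for pv25's REAL `Family` `B ↦ (re Q̃, (re Q·(re D + Σ_i B_i•re P_i)⁻¹·re Q′)⁻¹ + re S₀)` — the one-loop family of the model at level `k` with constraint `Q̃` — and the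
ONE displayed hypothesis that its bordered matrix at `B = 0` is nonsingular:
`((polarization F i j : ℝ) : ℂ) = −½·((𝒢·Σ_{ij}).trace − (𝒢·Σ_i·𝒢·Σ_j).trace)`, `𝒢 = flucCov (c⁻¹ + S₀) Q̃` (an2), `Σ_i = c⁻¹X_ic⁻¹`, `X_i = Q·D⁻¹P_iD⁻¹·Q′`, … — PART 166 `ofReal_polarization_of_isReal`
on these letters. [folklore] -/
theorem ofReal_polarization_firstOrderModel (L : ℕ) [NeZero L] (M : Fin d → ℕ) [∀ μ, NeZero (M μ)] (a : ℝ) (ha : 0 < a) (k : ℕ)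
    {V : ι → (k : ℕ) → Fin d → (idx L M k → ℂ)} (hV : ∀ i k μ x, conj (V i k μ x) = V i k μ x) (e : Fin n ≃ idx L M 0)
    {Q : Matrix (Fin n) (idx L M k) ℂ} {Q' : Matrix (idx L M k) (Fin n) ℂ} (hQ : Q = (((((L : ℝ) ^ d : ℝ) : ℂ) ^ k) • Atow (QBlev L M) k).submatrix e id)
    (hQ' : Q' = ((Atow (QBlev L M) k)ᴴ).submatrix id e) (S₀ : Matrix (Fin n) (Fin n) ℂ) (hS : IsReal S₀) (Qc : Matrix (Fin m) (Fin n) ℂ) (hQc : IsReal Qc)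
    (hK : (Matrix.fromBlocks ((Q * (calDalev L M a ha k)⁻¹ * Q')⁻¹ + S₀) Qcᵀ Qc 0).det ≠ 0) (i j : ι) :
    ((polarization (fun B : ι → ℝ => (⟨reM Qc, (reM Q * (reM (calDalev L M a ha k) + ∑ i, B i • reM (Pmodel L M (V i) k))⁻¹ * reM Q')⁻¹ + reM S₀⟩ :
        ConstrainedGaussian n m)) i j : ℝ) : ℂ) =
      -(1 / 2 : ℂ) * ((flucCov ((Q * (calDalev L M a ha k)⁻¹ * Q')⁻¹ + S₀) Qc
            * ((Q * (calDalev L M a ha k)⁻¹ * Q')⁻¹ * (Q * ((calDalev L M a ha k)⁻¹ * Pmodel L M (V i) k * (calDalev L M a ha k)⁻¹) * Q') * (Q * (calDalev L M a ha k)⁻¹ * Q')⁻¹ * (Q * ((calDalev L M a ha k)⁻¹ * Pmodel L M (V j) k * (calDalev L M a ha k)⁻¹) * Q') * (Q * (calDalev L M a ha k)⁻¹ * Q')⁻¹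
              + (Q * (calDalev L M a ha k)⁻¹ * Q')⁻¹ * (Q * ((calDalev L M a ha k)⁻¹ * Pmodel L M (V j) k * (calDalev L M a ha k)⁻¹) * Q') * (Q * (calDalev L M a ha k)⁻¹ * Q')⁻¹ * (Q * ((calDalev L M a ha k)⁻¹ * Pmodel L M (V i) k * (calDalev L M a ha k)⁻¹) * Q') * (Q * (calDalev L M a ha k)⁻¹ * Q')⁻¹
              - (Q * (calDalev L M a ha k)⁻¹ * Q')⁻¹ * (Q * ((calDalev L M a ha k)⁻¹ * Pmodel L M (V i) k * (calDalev L M a ha k)⁻¹ * Pmodel L M (V j) k * (calDalev L M a ha k)⁻¹ + (calDalev L M a ha k)⁻¹ * Pmodel L M (V j) k * (calDalev L M a ha k)⁻¹ * Pmodel L M (V i) k * (calDalev L M a ha k)⁻¹) * Q') * (Q * (calDalev L M a ha k)⁻¹ * Q')⁻¹)).trace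
        - (flucCov ((Q * (calDalev L M a ha k)⁻¹ * Q')⁻¹ + S₀) Qc * ((Q * (calDalev L M a ha k)⁻¹ * Q')⁻¹ * (Q * ((calDalev L M a ha k)⁻¹ * Pmodel L M (V i) k * (calDalev L M a ha k)⁻¹) * Q') * (Q * (calDalev L M a ha k)⁻¹ * Q')⁻¹)
            * flucCov ((Q * (calDalev L M a ha k)⁻¹ * Q')⁻¹ + S₀) Qc * ((Q * (calDalev L M a ha k)⁻¹ * Q')⁻¹ * (Q * ((calDalev L M a ha k)⁻¹ * Pmodel L M (V j) k * (calDalev L M a ha k)⁻¹) * Q') * (Q * (calDalev L M a ha k)⁻¹ * Q')⁻¹)).trace) := by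
  have hQr : IsReal Q := by
    rw [hQ]; exact isReal_submatrix (IsReal.smul (by rw [map_pow, Complex.conj_ofReal]) (isReal_Atow (isReal_QBlev L M) k)) _ _
  have hQ'r : IsReal Q' := by rw [hQ']; exact isReal_submatrix (isReal_Atow (isReal_QBlev L M) k).conjTranspose _ _
  have hc : IsUnit (Q * (calDalev L M a ha k)⁻¹ * Q').det := by rw [hQ, hQ']; exact isUnit_det_sandwich_zero L M a ha k e
  exact ofReal_polarization_of_isReal (calDalev L M a ha k) (fun i => Pmodel L M (V i) k) Q Q' S₀ Qc (isReal_calDalev L M a ha k)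
    (fun i => isReal_Pmodel L M (hV i) k) hQr hQ'r hS hQc (isUnit_det_calDalev L M a ha k) hc hK i j

end Polarization

end Summit.QuantumFields.BalabanUV.Beta.GAN24.FirstOrderModelRealLetters

end
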